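import Literature.AlgebraicGeometry.Morphisms.GeometricallyConnectedFibreLocusOpen
import Literature.AlgebraicGeometry.Morphisms.OpenSmoothFibreLocus
import HarnessLib

/-!
# The locus of smooth geometrically connected fibres of a proper flat morphism is open (MFK Prop. 7.3, step (I))

Topic `Literature/AlgebraicGeometry/Morphisms`; theorems only (no definition, no named fact, no instance, no notation, no
`sorry`).  Cell hodgecm-mathlib, F-DAG F-6 (I) brick U5 — the literal shape of [MumfordFogartyKirwan1994] Prop. 7.3, proof,
step (I): «the set `U₁` of points of the Hilbert scheme where the fibre is smooth and connected is open».  Assembles ★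
`Morphisms/OpenSmoothFibreLocus` (smooth over an open neighbourhood of a smooth fibre, EGA IV 17.5.1 / 12.2.4 (iii)) with ★
`Morphisms/GeometricallyConnectedFibreLocusOpen` (U4: the geometrically-connected-fibre locus of a smooth proper morphism is
open).  HC_CM is proved only modulo the 7 printed citations until rung 0 closes; nothing here bears on a summit statement.

* §1 **fibres do not see the restriction of the base to an open**: for `U ⊆ S` open and `u ∈ U`, the fibre
  `(p ∣_ U).fiber u → Spec κ_U(u)` is the base change of `p.fiber u → Spec κ_S(u)` along the isomorphism
  `Spec κ_U(u) ≅ Spec κ_S(u)` (`isPullback_fiber_morphismRestrict`: Mathlib `isPullback_morphismRestrict`,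
  `Hom.SpecMap_residueFieldMap_fromSpecResidueField`, `IsPullback.of_right`); hence every base-change-stable property of
  morphisms holds for one iff for the other (`iff_fiber_morphismRestrict`; instances `geometricallyConnected_…`, `smooth_…`);
* §2 **`isOpen_setOf_smooth_and_geometricallyConnected_fiber`**: for `p : X → S` proper and flat over a locally noetherian `S`,
  `{s | p.fiber s → Spec κ(s) is smooth and geometrically connected}` is OPEN.

## References
* D. Mumford, J. Fogarty, F. Kirwan, *Geometric Invariant Theory*, 3rd ed. (1994), Ch. 7 §2, Prop. 7.3, proof, step (I)
  (pp. 132–133). [MumfordFogartyKirwan1994]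
* A. Grothendieck, EGA IV₃ (Publ. Math. IHÉS 28, 1966), Thm. 12.2.4; EGA IV₄ (Publ. Math. IHÉS 32, 1967), Thm. 17.5.1. [EGAIV3] [EGAIV4]
* U. Görtz, T. Wedhorn, *Algebraic Geometry I: Schemes*, 2nd ed. (2020), Section (4.7) (pp. 107–108) (base change along an
  open subscheme). [GortzWedhorn2020]
-/

noncomputable section

set_option backward.isDefEq.respectTransparency false

open CategoryTheory CategoryTheory.Limits Opposite TopologicalSpace AlgebraicGeometry

universe u

namespace Literature.AlgebraicGeometry.Morphisms

/-! ## §1 The fibre of `p ∣_ U` at `u` is a base change of the fibre of `p` at `u` along an isomorphism -/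

section Restrict

variable {X S : Scheme.{u}} (p : X ⟶ S) (U : S.Opens) (u : U)

/-- **The fibre of the restricted family is a base change of the fibre**: for `U ⊆ S` open and `u ∈ U`, there is a morphism
`(p ∣_ U).fiber u ⟶ p.fiber (U.ι u)` making `(p ∣_ U).fiber u → Spec κ_U(u)` the base change of `p.fiber (U.ι u) → Spec κ_S(U.ι u)`
along `Spec (U.ι.residueFieldMap u) : Spec κ_U(u) ⟶ Spec κ_S(U.ι u)` (an isomorphism, `U.ι` being an open immersion).
[cite: GortzWedhorn2020, Section (4.7) (pp. 107–108)] -/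
theorem isPullback_fiber_morphismRestrict :
    ∃ l : (p ∣_ U).fiber u ⟶ p.fiber (U.ι.base u),
      IsPullback l ((p ∣_ U).fiberToSpecResidueField u) (p.fiberToSpecResidueField (U.ι.base u))
        (Spec.map (U.ι.residueFieldMap u)) := by
  have hC := IsPullback.of_hasPullback p (S.fromSpecResidueField (U.ι.base u))
  -- the fibre square of `p ∣_ U` at `u`, pasted on top of the restriction square, is cartesian over
  -- `Spec κ_U(u) → U → S = Spec (residueFieldMap) ≫ Spec κ_S(U.ι u) → S`
  have big : IsPullback ((p ∣_ U).fiberι u ≫ (p ⁻¹ᵁ U).ι) ((p ∣_ U).fiberToSpecResidueField u) p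
      (Spec.map (U.ι.residueFieldMap u) ≫ S.fromSpecResidueField (U.ι.base u)) := by
    rw [Scheme.Hom.SpecMap_residueFieldMap_fromSpecResidueField]
    exact (IsPullback.of_hasPullback (p ∣_ U) ((U : Scheme.{u}).fromSpecResidueField u)).paste_horiz
      (isPullback_morphismRestrict p U).flip
  have w : ((p ∣_ U).fiberι u ≫ (p ⁻¹ᵁ U).ι) ≫ p =
      (((p ∣_ U).fiberToSpecResidueField u) ≫ Spec.map (U.ι.residueFieldMap u)) ≫
        S.fromSpecResidueField (U.ι.base u) := by
    rw [big.w, Category.assoc]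
  refine ⟨hC.lift _ _ w, ?_⟩
  have key := IsPullback.of_right (h₁₂ := pullback.fst p (S.fromSpecResidueField (U.ι.base u)))
    (by rw [hC.lift_fst _ _ w]; exact big) (hC.lift_snd _ _ w) hC
  exact key

/-- **Base-change-stable properties of the fibre do not see the restriction**: for `P` stable under base change (hence
respecting isomorphisms), `P ((p ∣_ U).fiber u → Spec κ_U(u)) ↔ P (p.fiber (U.ι u) → Spec κ_S(U.ι u))`.
[cite: GortzWedhorn2020, Section (4.7) (pp. 107–108)] -/
theorem iff_fiber_morphismRestrict (P : MorphismProperty Scheme.{u}) [P.IsStableUnderBaseChange] :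
    P ((p ∣_ U).fiberToSpecResidueField u) ↔ P (p.fiberToSpecResidueField (U.ι.base u)) := by
  obtain ⟨l, hl⟩ := isPullback_fiber_morphismRestrict p U u
  constructor
  · intro h
    -- the bottom of the square is an isomorphism, hence so is `l`, and `P` respects isomorphisms
    haveI : IsIso l := hl.isIso_fst_of_isIso
    have e : p.fiberToSpecResidueField (U.ι.base u) =
        inv l ≫ (p ∣_ U).fiberToSpecResidueField u ≫ Spec.map (U.ι.residueFieldMap u) := by
      rw [← hl.w, IsIso.inv_hom_id_assoc]
    rw [e]
    exact MorphismProperty.RespectsIso.precomp P _ _ (MorphismProperty.RespectsIso.postcomp P _ _ h)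
  · intro h
    exact MorphismProperty.of_isPullback hl h

/-- The fibre of `p ∣_ U` at `u` is geometrically connected iff the fibre of `p` at `u` is.
[cite: GortzWedhorn2020, Section (4.7) (pp. 107–108)] -/
theorem geometricallyConnected_fiber_morphismRestrict_iff :
    GeometricallyConnected ((p ∣_ U).fiberToSpecResidueField u) ↔
      GeometricallyConnected (p.fiberToSpecResidueField (U.ι.base u)) :=
  iff_fiber_morphismRestrict p U u @GeometricallyConnected

/-- The fibre of `p ∣_ U` at `u` is smooth iff the fibre of `p` at `u` is. [cite: GortzWedhorn2020, Section (4.7) (pp. 107–108)] -/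
theorem smooth_fiber_morphismRestrict_iff :
    Smooth ((p ∣_ U).fiberToSpecResidueField u) ↔ Smooth (p.fiberToSpecResidueField (U.ι.base u)) :=
  iff_fiber_morphismRestrict p U u @Smooth

end Restrict

/-! ## §2 MFK Prop. 7.3, step (I): the locus of smooth geometrically connected fibres is open -/

section Locus

variable {X S : Scheme.{0}} (p : X ⟶ S) [IsProper p] [Flat p] [IsLocallyNoetherian S]

/-- **THE LOCUS OF SMOOTH GEOMETRICALLY CONNECTED FIBRES IS OPEN** ([MumfordFogartyKirwan1994] Prop. 7.3, proof, step (I)):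
for `p : X → S` proper and flat over a locally noetherian `S`, the set of `s ∈ S` whose fibre `p.fiber s → Spec κ(s)` is smooth
and geometrically connected is open.  Near a smooth fibre `p` is smooth over an open `V ∋ s` (★
`exists_smooth_morphismRestrict_of_smooth_fiber`, EGA IV 17.5.1); on `V` the geometrically-connected-fibre locus of the smooth
proper `p ∣_ V` is open (★ `isOpen_setOf_geometricallyConnected_fiber_of_smooth`, U4) and its fibres are those of `p` (§1).
[cite: MumfordFogartyKirwan1994, Ch. 7 §2, Prop. 7.3, proof, step (I) (pp. 132–133)] [cite: EGAIV3, Thm. 12.2.4] -/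
theorem isOpen_setOf_smooth_and_geometricallyConnected_fiber :
    IsOpen {s : S | Smooth (p.fiberToSpecResidueField s) ∧ GeometricallyConnected (p.fiberToSpecResidueField s)} := by
  rw [isOpen_iff_forall_mem_open]
  rintro s ⟨hsm, hconn⟩
  obtain ⟨V, hsV, hV⟩ := exists_smooth_morphismRestrict_of_smooth_fiber p (fun x _ => Flat.stalkMap p x) hsm
  haveI := hV
  let W : Set V := {v : V | GeometricallyConnected ((p ∣_ V).fiberToSpecResidueField v)}
  have hW : IsOpen W := isOpen_setOf_geometricallyConnected_fiber_of_smooth (p ∣_ V)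
  refine ⟨V.ι.base '' W, ?_, V.ι.isOpenEmbedding.isOpenMap _ hW, ?_⟩
  · rintro _ ⟨v, hv, rfl⟩
    have hvV : V.ι.base v ∈ V := by rw [Scheme.Opens.ι_apply]; exact v.2
    exact ⟨Literature.AlgebraicGeometry.Resolution.smooth_fiberToSpecResidueField_of_mem p V hvV,
      (geometricallyConnected_fiber_morphismRestrict_iff p V v).1 hv⟩
  · refine ⟨⟨s, hsV⟩, ?_, rfl⟩
    change GeometricallyConnected _
    exact (geometricallyConnected_fiber_morphismRestrict_iff p V ⟨s, hsV⟩).2 hconn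

end Locus

end Literature.AlgebraicGeometry.Morphisms

end
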